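import Summits.HodgeConjecture.HodgeConjecture.Theorems.NikulinTwinTransportTwinTwistorTransportMukaiLiftDefs
import Literature.AlgebraicGeometry.Surfaces.K3PeriodSurjectivityProofs
import Mathlib.RingTheory.Localization.Integer

/-!
# Crux `NikulinTwinTransport.TwinTwistorTransport` (stmt-HodgeConjecture-14393), line
# `mukai-lift-full-similitude`, heart `LiftEngine`: MATCHED GENERIC TWISTOR LINES one level up

Lead c3 (prover-line-stmt-HodgeConjecture-14393-c3-0), 2026-08-16. The heart `LiftEngine` transports the
Mukai lift `M̃ = liftEnd M` of the twin `2`-similitude along chains of GENERIC twistor lines of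
`(L, q₂) = Λ_{K3} ⊕ ⟨−2⟩` on the `X′`-side (stub `TwistorReach`, landed). Any transport argument à la
Buskin / Markman (diagonal twistor paths of `ψ̃`-MATCHED hyperkähler structures, Markman 2024 §5.2 with
an isometry replaced by a `2`-similitude) needs the book-keeping proved here: the lift `M̃` is REAL
(defined over `ℚ`), so it carries a positive three-space `W ⊂ L_ℝ` of `q₂` to the positive three-space
`M̃_ℝ W` of `q₃` (`q₃(M̃u, M̃v) = 2 q₂(u, v)`), GENERIC to generic (the rational inverse `Ñ` and a common
denominator move integral normal vectors back), and `M̃`-matched periods of points of a common generic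
`q₂`-twistor line lie on a common generic `q₃`-twistor line. So a chain of generic lines from the anchor
period `(x₀′, 0)` to `(x′, 0)` on the `K3^{[2]}` side is shadowed, period by period, by a chain of generic
lines on the `K3^{[3]}` side — the diagonal twistor path of the matched family `𝒯̃`.

Statements (all `--supports stmt-HodgeConjecture-14393`; registered sub-goal `matched_onCommonGenericLiftLine`):
* `IsRatEnd.star_apply` — a `ℚ`-defined endomorphism of `Λ_ℂ` commutes with complex conjugation;
* `liftEnd_ofRL` — `M̃` maps real vectors to real vectors (`M̃ (ofRL u) = ofRL (liftReal M u)`-shape);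
* `matched_mem_liftPeriodDomain` — `M̃ x = s • z`, `s ≠ 0`, `x ∈ D₂` ⟹ `z ∈ D₃`;
* `matched_onCommonGenericLiftLine` — `OnCommonGenericLiftLine 2 x y`, `M̃ x = s • z`, `M̃ y = t • w`
  (`s, t ≠ 0`) ⟹ `OnCommonGenericLiftLine 3 z w`, for every rational `2`-similitude pair `(M, N)`.

References: [Markman2024] E. Markman, Compos. Math. 160 (2024), §5.2 (diagonal twistor paths, Def. 5.13,
Lemma 5.14); [Huybrechts2016K3] Ch. 7 §3.1; [Buskin2019] §5.
-/

-- `Summit.HodgeConjecture.HodgeConjecture.…` (summit = problem) duplicates a namespace component by design (D-0017).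
set_option linter.dupNamespace false

noncomputable section

namespace Summit.HodgeConjecture.HodgeConjecture.Theorems.TwinTwistorTransport.MukaiLift

open scoped BigOperators ComplexConjugate
open Literature.AlgebraicGeometry.Surfaces

/-! ### Real structure: a `ℚ`-defined endomorphism commutes with conjugation -/

/-- The columns of a `ℚ`-defined endomorphism of `Λ_ℂ` are rational vectors. [folklore] -/
theorem IsRatEnd.exists_col {M : Module.End ℂ (K3Index → ℂ)} (hM : IsRatEnd M) (i : K3Index) :
    ∃ w : K3Index → ℚ, M (fun j => if i = j then (1 : ℂ) else 0) = fun j => (w j : ℂ) := by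
  obtain ⟨w, hw⟩ := hM (fun j => if i = j then 1 else 0)
  refine ⟨w, ?_⟩
  rw [← hw]
  congr 1
  funext j
  split_ifs <;> simp

/-- A `ℚ`-defined endomorphism of `Λ_ℂ` commutes with complex conjugation: `star (M y) = M (star y)`.
[folklore] -/
theorem IsRatEnd.star_apply {M : Module.End ℂ (K3Index → ℂ)} (hM : IsRatEnd M) (y : K3Index → ℂ) :
    star (M y) = M (star y) := by
  have hy : y = ∑ i, y i • fun j => if i = j then (1 : ℂ) else 0 := pi_eq_sum_univ y
  have hsy : star y = ∑ i, star (y i) • fun j => if i = j then (1 : ℂ) else 0 := by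
    conv_lhs => rw [hy]
    rw [star_sum]
    refine Finset.sum_congr rfl fun i _ => ?_
    funext j
    simp only [Pi.star_apply, Pi.smul_apply, smul_eq_mul, star_mul', mul_eq_mul_left_iff]
    left
    split_ifs <;> simp
  conv_lhs => rw [hy]
  rw [hsy, map_sum, map_sum, star_sum]
  refine Finset.sum_congr rfl fun i _ => ?_
  rw [map_smul, map_smul, star_smul]
  congr 1
  obtain ⟨w, hw⟩ := hM.exists_col i
  rw [hw]
  funext j
  simp

/-- A `ℚ`-defined endomorphism maps real vectors to real vectors. [folklore] -/
theorem IsRatEnd.star_apply_of_star_eq {M : Module.End ℂ (K3Index → ℂ)} (hM : IsRatEnd M)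
    {y : K3Index → ℂ} (hy : star y = y) : star (M y) = M y := by
  rw [hM.star_apply, hy]

/-! ### The lift on real vectors -/

/-- `ofRL` is additive. [folklore] -/
theorem ofRL_add (u w : (K3Index → ℝ) × ℝ) : ofRL (u + w) = ofRL u + ofRL w := by
  ext i <;> simp [ofRL]

/-- `ofRL` is `ℝ`-homogeneous. [folklore] -/
theorem ofRL_smul (r : ℝ) (u : (K3Index → ℝ) × ℝ) : ofRL (r • u) = (r : ℂ) • ofRL u := by
  ext i <;> simp [ofRL]

/-- Real vectors are fixed by conjugation. [folklore] -/
theorem star_ofRL (u : (K3Index → ℝ) × ℝ) : star (ofRL u) = ofRL u := by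
  ext i <;> simp [ofRL, Prod.star_def]

/-- `reL ∘ ofRL = id`. [folklore] -/
@[simp] theorem reL_ofRL (u : (K3Index → ℝ) × ℝ) : reL (ofRL u) = u := by
  ext i <;> simp [reL, ofRL]

/-- A vector of `L` fixed by conjugation is the image of its real part. [folklore] -/
theorem ofRL_reL_of_star_eq {x : LiftLat} (hx : star x = x) : ofRL (reL x) = x := by
  have h1 : ∀ i, star (x.1 i) = x.1 i := fun i => by
    have := congrArg (fun z : LiftLat => z.1 i) hx
    simpa [Prod.star_def] using this
  have h2 : star x.2 = x.2 := by
    have := congrArg (fun z : LiftLat => z.2) hx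
    simpa [Prod.star_def] using this
  ext i
  · simp only [ofRL, reL]
    exact Complex.conj_eq_iff_re.mp (h1 i) ▸ rfl
  · simp only [ofRL, reL]
    exact Complex.conj_eq_iff_re.mp h2 ▸ rfl

/-- The lift of a `ℚ`-defined endomorphism maps real vectors of `L` to real vectors:
`M̃ (ofRL u) = ofRL (reL (M̃ (ofRL u)))`. [folklore] -/
theorem liftEnd_ofRL {M : Module.End ℂ (K3Index → ℂ)} (hM : IsRatEnd M) (u : (K3Index → ℝ) × ℝ) :
    liftEnd M (ofRL u) = ofRL (reL (liftEnd M (ofRL u))) := by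
  refine (ofRL_reL_of_star_eq ?_).symm
  have h1 : star (fun i => ((u.1 i : ℝ) : ℂ)) = fun i => ((u.1 i : ℝ) : ℂ) := by
    funext i; simp
  ext i
  · simp only [liftEnd_apply, ofRL, Prod.star_def]
    rw [hM.star_apply_of_star_eq h1]
  · simp [liftEnd_apply, ofRL, Prod.star_def]

/-- The lift commutes with conjugation on all of `L`. [folklore] -/
theorem star_liftEnd {M : Module.End ℂ (K3Index → ℂ)} (hM : IsRatEnd M) (x : LiftLat) :
    star (liftEnd M x) = liftEnd M (star x) := by
  ext i <;> simp [liftEnd_apply, Prod.star_def, hM.star_apply]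

/-- Every vector of `L` is `re + i·im`. [folklore] -/
theorem ofRL_reL_add_I_smul (x : LiftLat) : ofRL (reL x) + Complex.I • ofRL (imL x) = x := by
  ext i <;> simp [ofRL, reL, imL, Complex.re_add_im, mul_comm Complex.I]

/-- Real part of `c • (ofRL p + i · ofRL q)`. [folklore] -/
theorem reL_smul_ofRL_add (c : ℂ) (p q : (K3Index → ℝ) × ℝ) :
    reL (c • (ofRL p + Complex.I • ofRL q)) = c.re • p - c.im • q := by
  ext i <;> simp [reL, ofRL, Complex.mul_re, Complex.mul_im]
  ring

/-- Imaginary part of `c • (ofRL p + i · ofRL q)`. [folklore] -/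
theorem imL_smul_ofRL_add (c : ℂ) (p q : (K3Index → ℝ) × ℝ) :
    imL (c • (ofRL p + Complex.I • ofRL q)) = c.im • p + c.re • q := by
  ext i <;> simp [imL, ofRL, Complex.mul_re, Complex.mul_im]
  ring

/-! ### Bilinearity of `liftForm` -/

/-- `liftForm` is homogeneous in the first argument. [folklore] -/
theorem liftForm_smul_left (n : ℕ) (c : ℂ) (u v : LiftLat) :
    liftForm n (c • u) v = c * liftForm n u v := by
  simp only [liftForm, Prod.smul_fst, Prod.smul_snd, k3Form_smul_left, smul_eq_mul]
  ring

/-- `liftForm` is homogeneous in the second argument. [folklore] -/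
theorem liftForm_smul_right (n : ℕ) (c : ℂ) (u v : LiftLat) :
    liftForm n u (c • v) = c * liftForm n u v := by
  simp only [liftForm, Prod.smul_fst, Prod.smul_snd, k3Form_smul_right, smul_eq_mul]
  ring

/-- `liftForm` is additive in the second argument. [folklore] -/
theorem liftForm_add_right (n : ℕ) (u v w : LiftLat) :
    liftForm n u (v + w) = liftForm n u v + liftForm n u w := by
  simp only [liftForm, Prod.fst_add, Prod.snd_add, k3Form_add_right]
  ring

/-! ### Matched periods -/

/-- **Matched periods lie in the period domain.** If `M` is a `2`-similitude defined over `ℚ` and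
`M̃ x = s • z` with `s ≠ 0`, `x ∈ D₂`, then `z ∈ D₃` (`q₃(z) = 2s⁻² q₂(x) = 0`,
`q₃(z̄, z) = 2|s|⁻² q₂(x̄, x) > 0`). [folklore] -/
theorem matched_mem_liftPeriodDomain {M : Module.End ℂ (K3Index → ℂ)} (hM : IsRatEnd M)
    (hM2 : ∀ a b, k3Form (M a) (M b) = 2 * k3Form a b) {x z : LiftLat} {s : ℂ} (hs : s ≠ 0)
    (hz : liftEnd M x = s • z) (hx : x ∈ liftPeriodDomain 2) : z ∈ liftPeriodDomain 3 := by
  have hz' : z = s⁻¹ • liftEnd M x := by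
    rw [hz, smul_smul, inv_mul_cancel₀ hs, one_smul]
  refine ⟨?_, ?_⟩
  · rw [hz', liftForm_smul_left, liftForm_smul_right, liftForm_liftEnd M hM2, hx.1]
    ring
  · have hstar : star z = (starRingEnd ℂ s)⁻¹ • liftEnd M (star x) := by
      rw [hz', star_smul, star_inv₀, star_liftEnd hM]
      rfl
    rw [hstar, hz', liftForm_smul_left, liftForm_smul_right, liftForm_liftEnd M hM2]
    have hss : (starRingEnd ℂ s)⁻¹ * (s⁻¹ * (2 * liftForm 2 (star x) x)) =
        (((Complex.normSq s)⁻¹ * 2 : ℝ) : ℂ) * liftForm 2 (star x) x := by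
      push_cast
      rw [Complex.normSq_eq_conj_mul_self, mul_inv]
      ring
    rw [hss, Complex.re_ofReal_mul]
    exact mul_pos (mul_pos (inv_pos.2 (Complex.normSq_pos.2 hs)) two_pos) hx.2

/-- **MATCHED GENERIC TWISTOR LINES (registered sub-goal).** Let `(M, N)` be a rational
`2`-similitude pair of `Λ_ℂ` and `M̃ = liftEnd M` its Mukai lift. If `x`, `y` lie on a common GENERIC
twistor line of `(L, q₂)` (a positive three-space `W ⊂ L_ℝ` with `W^⊥ ∩ (Λ ⊕ ℤδ) = 0` containing the
real and imaginary parts of both) and `M̃ x = s • z`, `M̃ y = t • w` with `s, t ≠ 0`, then `z`, `w` lie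
on a common generic twistor line of `(L, q₃)`, namely that of `M̃_ℝ W`: positivity from
`q₃(M̃u, M̃u) = 2 q₂(u, u)`, dimension `3` from injectivity, genericity because an integral vector
`q₃`-orthogonal to `M̃_ℝ W` has `Ñ`-image `q₂`-orthogonal to `W`, rational, hence `0` after clearing
denominators. This is the period book-keeping of the DIAGONAL twistor path of `ψ̃`-matched hyperkähler
structures (Markman 2024 §5.2, one similitude instead of an isometry).
[cite: Markman2024, §5.2 Def. 5.13 and Lemma 5.14] -/
theorem matched_onCommonGenericLiftLine : ∀ (M N : Module.End ℂ (K3Index → ℂ)), IsTwoSimilitudePair M N → ∀ {x y z w : LiftLat} {s t : ℂ}, s ≠ 0 → t ≠ 0 → liftEnd M x = s • z → liftEnd M y = t • w → OnCommonGenericLiftLine 2 x y → OnCommonGenericLiftLine 3 z w := by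
  intro M N hMN x y z w s t hs ht hz hw hxy
  obtain ⟨hMrat, hNrat, hMN1, hNM1, hM2⟩ := hMN
  obtain ⟨W, hWpos, hWgen, hxW, hyW⟩ := hxy
  -- the real form `f` of `M̃` on `L_ℝ`
  let f : ((K3Index → ℝ) × ℝ) →ₗ[ℝ] ((K3Index → ℝ) × ℝ) :=
    { toFun := fun u => reL (liftEnd M (ofRL u))
      map_add' := fun u v => by
        have : liftEnd M (ofRL (u + v)) = liftEnd M (ofRL u) + liftEnd M (ofRL v) := by
          rw [ofRL_add, map_add]
        ext i <;> simp [this, reL]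
      map_smul' := fun r u => by
        have : liftEnd M (ofRL (r • u)) = (r : ℂ) • liftEnd M (ofRL u) := by
          rw [ofRL_smul, map_smul]
        ext i <;> simp [this, reL] }
  have hf : ∀ u, ofRL (f u) = liftEnd M (ofRL u) := fun u => (liftEnd_ofRL hMrat u).symm
  -- `M̃` is injective (two-sided inverse `Ñ`)
  have hinjL : Function.Injective (liftEnd M) := by
    intro a b hab
    have h := congrArg (liftEnd N) hab
    have hNM : liftEnd N * liftEnd M = 1 := liftEnd_mul_eq_one hNM1
    have ha : liftEnd N (liftEnd M a) = a := by
      rw [← Module.End.mul_apply, hNM, Module.End.one_apply]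
    have hb : liftEnd N (liftEnd M b) = b := by
      rw [← Module.End.mul_apply, hNM, Module.End.one_apply]
    rwa [ha, hb] at h
  have hofRL_inj : Function.Injective (ofRL : (K3Index → ℝ) × ℝ → LiftLat) := by
    intro a b hab
    have := congrArg reL hab
    simpa using this
  have hfinj : Function.Injective f := by
    intro a b hab
    apply hofRL_inj
    apply hinjL
    rw [← hf, ← hf, hab]
  refine ⟨W.map f, ⟨?_, ?_⟩, ?_, ?_, ?_⟩
  · -- dimension 3
    rw [← hWpos.1]
    exact (LinearEquiv.finrank_eq (Submodule.equivMapOfInjective f hfinj W)).symm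
  · -- positivity for `q₃`
    rintro _ ⟨u, hu, rfl⟩ hne
    have hu0 : u ≠ 0 := by
      rintro rfl
      exact hne (map_zero f)
    rw [hf, liftForm_liftEnd M hM2]
    have := hWpos.2 u hu hu0
    rw [Complex.mul_re]
    simp only [Complex.re_ofNat, Complex.im_ofNat, zero_mul, sub_zero]
    positivity
  · -- genericity for `q₃`
    intro v k hvk
    -- `a := Ñ (v, k)` is rational and `q₂`-orthogonal to `W`
    obtain ⟨q, l, hql⟩ := liftEnd_ofZL hNrat v k
    have hMa : liftEnd M (liftEnd N (ofZL v k)) = ofZL v k := by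
      rw [← Module.End.mul_apply, liftEnd_mul_eq_one hMN1, Module.End.one_apply]
    have horth : ∀ u ∈ W, liftForm 2 (liftEnd N (ofZL v k)) (ofRL u) = 0 := by
      intro u hu
      have h1 := hvk (f u) (Submodule.mem_map_of_mem hu)
      rw [hf, ← hMa, liftForm_liftEnd M hM2] at h1
      simpa using h1
    -- clear denominators: `d • a` is integral
    obtain ⟨⟨d, hd⟩, hdint⟩ := IsLocalization.exist_integer_multiples_of_finset (nonZeroDivisors ℤ)
      (insert l (Finset.univ.image q))
    have hd0 : (d : ℤ) ≠ 0 := nonZeroDivisors.ne_zero hd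
    have hcoord : ∀ r ∈ insert l (Finset.univ.image q), ∃ m : ℤ, (m : ℚ) = d * r := by
      intro r hr
      obtain ⟨m, hm⟩ := hdint r hr
      exact ⟨m, by simpa [Submonoid.smul_def, zsmul_eq_mul] using hm⟩
    choose! m hm using hcoord
    have hql' : liftEnd N (ofZL v k) = (fun i => (q i : ℂ), (l : ℂ)) := hql
    have hscaled : ((d : ℤ) : ℂ) • liftEnd N (ofZL v k) = ofZL (fun i => m (q i)) (m l) := by
      rw [hql']
      ext i
      · simp only [Prod.smul_fst, Pi.smul_apply, smul_eq_mul, ofZL]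
        have := hm (q i) (Finset.mem_insert_of_mem (Finset.mem_image_of_mem q (Finset.mem_univ i)))
        rw [← Rat.cast_intCast (α := ℂ) (m (q i)), this]
        push_cast
        ring
      · simp only [Prod.smul_snd, smul_eq_mul, ofZL]
        have := hm l (Finset.mem_insert_self l _)
        rw [← Rat.cast_intCast (α := ℂ) (m l), this]
        push_cast
        ring
    have horth' : ∀ u ∈ W, liftForm 2 (ofZL (fun i => m (q i)) (m l)) (ofRL u) = 0 := by
      intro u hu
      rw [← hscaled, liftForm_smul_left, horth u hu, mul_zero]
    obtain ⟨hv0, hk0⟩ := hWgen _ _ horth'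
    have hzero : ((d : ℤ) : ℂ) • liftEnd N (ofZL v k) = 0 := by
      rw [hscaled]
      ext i
      · have hi := congrFun hv0 i
        simp only [Pi.zero_apply] at hi
        simp [ofZL, hi]
      · simp [ofZL, hk0]
    have ha0 : liftEnd N (ofZL v k) = 0 := by
      rcases smul_eq_zero.1 hzero with h | h
      · exact absurd (by exact_mod_cast h) hd0
      · exact h
    have hvk0 : ofZL v k = 0 := by rw [← hMa, ha0, map_zero]
    constructor
    · funext i
      have := congrArg (fun z : LiftLat => z.1 i) hvk0
      simpa [ofZL] using this
    · have := congrArg (fun z : LiftLat => z.2) hvk0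
      simpa [ofZL] using this
  · -- `z` on the matched line
    exact matched_mem_line hMrat hM2 hs hz hxW hf
  · exact matched_mem_line hMrat hM2 ht hw hyW hf
  where
  /-- A matched period lies on the matched twistor line. -/
  matched_mem_line {M : Module.End ℂ (K3Index → ℂ)} (hMrat : IsRatEnd M)
      (hM2 : ∀ a b, k3Form (M a) (M b) = 2 * k3Form a b) {x z : LiftLat} {s : ℂ} (hs : s ≠ 0)
      (hz : liftEnd M x = s • z) {W : Submodule ℝ ((K3Index → ℝ) × ℝ)}
      (hxW : x ∈ liftTwistorLine 2 W) {f : ((K3Index → ℝ) × ℝ) →ₗ[ℝ] ((K3Index → ℝ) × ℝ)}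
      (hf : ∀ u, ofRL (f u) = liftEnd M (ofRL u)) : z ∈ liftTwistorLine 3 (W.map f) := by
    obtain ⟨hxD, hre, him⟩ := hxW
    have hz' : z = s⁻¹ • liftEnd M x := by
      rw [hz, smul_smul, inv_mul_cancel₀ hs, one_smul]
    have hMx : liftEnd M x = ofRL (f (reL x)) + Complex.I • ofRL (f (imL x)) := by
      conv_lhs => rw [← ofRL_reL_add_I_smul x]
      rw [map_add, map_smul, hf, hf]
    refine ⟨matched_mem_liftPeriodDomain hMrat hM2 hs hz hxD, ?_, ?_⟩
    · rw [hz', hMx, reL_smul_ofRL_add]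
      exact W.map f |>.sub_mem (Submodule.smul_mem _ _ (Submodule.mem_map_of_mem hre))
        (Submodule.smul_mem _ _ (Submodule.mem_map_of_mem him))
    · rw [hz', hMx, imL_smul_ofRL_add]
      exact (W.map f).add_mem (Submodule.smul_mem _ _ (Submodule.mem_map_of_mem hre))
        (Submodule.smul_mem _ _ (Submodule.mem_map_of_mem him))

/-! ### Matched chains (appended 2026-08-16, lead c3) -/

/-- **The shadow chain.** For a rational `2`-similitude pair `(M, N)`, a chain of generic twistor lines of
`(L, q₂)` from `x` to `y` is carried by the Mukai lift `M̃` to a chain of generic twistor lines of `(L, q₃)`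
from `M̃ x` to `M̃ y` (apply `matched_onCommonGenericLiftLine` with `s = t = 1` at every step): the
`K3^{[3]}`-side of the diagonal twistor path exists whenever the `K3^{[2]}`-side does.
[cite: Markman2024, §5.2 Def. 5.13 and Lemma 5.14] -/
theorem matched_chain {M N : Module.End ℂ (K3Index → ℂ)} (hMN : IsTwoSimilitudePair M N) {x y : LiftLat}
    (h : Relation.ReflTransGen (OnCommonGenericLiftLine 2) x y) :
    Relation.ReflTransGen (OnCommonGenericLiftLine 3) (liftEnd M x) (liftEnd M y) := by
  induction h with
  | refl => exact Relation.ReflTransGen.refl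
  | tail _ hbc ih =>
    exact ih.tail (matched_onCommonGenericLiftLine M N hMN one_ne_zero one_ne_zero
      (one_smul ℂ _).symm (one_smul ℂ _).symm hbc)


end Summit.HodgeConjecture.HodgeConjecture.Theorems.TwinTwistorTransport.MukaiLift

end
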